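/-
Copyright (c) 2026 the pub-hodgecm-mathlib formalisation cell (harness21).  Prover seat hodgecm-mathlib-K2E5-p10 (g4), Track B «K2-LIT» ∕ h413
(`stmt-HodgeConjecture-24833`), line `K2_E3_EllipticInputs`, unit U12, §L road «U-iso-T» brick (G⁺-b)/(K4-b2): THE SPLIT CELL QUADRATIC —
`|∫_{𝔭^β} 1[R ∉ 𝔭^b] χ̃(R)‖R‖⁻¹| ≤ (3 + q^e)·‖r₂(σ₁−σ₂)‖⁻¹·μ(𝒪)` for `R = r₂(σ−σ₁)(σ−σ₂)`, uniformly in the truncation `b`.  2026-09-04.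
-/
import Summits.HodgeConjecture.HodgeConjecture.Theorems.K2E3LocalFieldQuadraticWeightBoundLemmas   -- ★ (this seat): (K4-b1) model annulus ∕ localised ball bounds
import HarnessLib

/-!
# K2_E3 road (h413), §L brick (G⁺-b)/(K4-b2) — uniform bound for the split cell quadratic

Cell `pub/hodgecm-mathlib` (D-0151), Track B, seat K2E5-p10 (g4) (E3 §L line; dealer K2E3-plan (g3); (G⁺-b): line side K2E5-p17 (g3) ★, `K`-side this seat).
`--supports stmt-HodgeConjecture-24833 --as helper`; THEOREMS ONLY (no definition ∕ instance ∕ notation ∕ named fact ∕ `sorry`); never imports `Cruxes/…/Lines`.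
COUNT-NEUTRAL.

`χ` quadratic `≠ 1` with conductor ball `𝔭^e`, `ψ(y) = χ̃(y)‖y‖⁻¹`, `R(σ) = r₂(σ − σ₁)(σ − σ₂)`, `d = σ₁ − σ₂ ≠ 0` (`|disc R|^{1∕2} = ‖r₂ d‖`),
`ρ = ‖d‖(q⁻¹)^e`.  §1 outside the two localisation balls `∫_O ‖R‖⁻¹ ≤ ‖r₂‖⁻¹‖d‖⁻¹μ(𝒪) + ‖r₂‖⁻¹ρ⁻¹μ(𝒪)` (‖v‖⁻² tail ★ p857429; a set of measure
`≤ ‖d‖μ(𝒪)` where the two distances are `> ρ` and one is `≥ ‖d‖`); §2 translated balls carry `≤ μ(𝒪)` of the model weight; §3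
**`norm_setIntegral_trunc_split_le`**: `|∫_{𝔭^β} 1[R ∉ 𝔭^b] ψ(R)| ≤ (3 + q^e)·‖r₂ d‖⁻¹·μ(𝒪)` uniformly in `b`, `β`.
[HarishChandra1999AdmissibleDistributions, §7] [LabesseLanglands1979, §2] [Tate1950, §2.5]
HONEST LABEL: HC_CM is proved only modulo the 7 printed citations (2 remaining named inputs: hLiu418 = stmt-HodgeConjecture-24832, h413 =
stmt-HodgeConjecture-24833) until rung 0 closes; count-neutral helper toward (LBU-2⁺)∕(G⁺-b), NOT ★.

## References
* [HarishChandra1999AdmissibleDistributions] Harish-Chandra (DeBacker–Sally), *Admissible Invariant Distributions on Reductive p-adic Groups* (1999), §7.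
* [LabesseLanglands1979] J.-P. Labesse, R. P. Langlands, *L-indistinguishability for SL(2)*, Canad. J. Math. 31 (1979), §2.
* [Tate1950] J. Tate, *Fourier analysis in number fields and Hecke's zeta-functions* (1950), §2.5.
-/

set_option autoImplicit false
set_option linter.dupNamespace false   -- `Summit.HodgeConjecture.HodgeConjecture.…` (D-0017 nested layout; lakefile exemption for Summits)

noncomputable section

open MeasureTheory Measure Filter Topology Set
open scoped NNReal ENNReal Pointwise
open ValuativeRel
open Literature.NumberTheory.Automorphic Literature.NumberTheory.Automorphic.LocalFieldHaar Literature.NumberTheory.Automorphic.TateDirect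
open Literature.NumberTheory.GaloisRepresentations Literature.NumberTheory.GaloisRepresentations.IsNonarchimedeanLocalField
open Summit.HodgeConjecture.HodgeConjecture.Cruxes.H413.K2E3LocalFieldSignCharZetaBalls
open Summit.HodgeConjecture.HodgeConjecture.Cruxes.H413.K2E3LocalFieldQuadraticCharSignWeight
open Summit.HodgeConjecture.HodgeConjecture.Cruxes.H413.K2E3LocalFieldQuadraticCharLocalisation
open Summit.HodgeConjecture.HodgeConjecture.Cruxes.H413.K2E3LocalFieldQuadraticWeightElliptic
open Summit.HodgeConjecture.HodgeConjecture.Cruxes.H413.K2E3LocalFieldQuadraticWeightEventuallyConst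
open Summit.HodgeConjecture.HodgeConjecture.Cruxes.H413.K2E3LocalFieldQuadraticWeightBoundLemmas

namespace Summit.HodgeConjecture.HodgeConjecture.Cruxes.H413.K2E3LocalFieldQuadraticWeightBoundSplit

variable {F : Type*} [Field F] [ValuativeRel F] [TopologicalSpace F] [IsNonarchimedeanLocalField F]
  [MeasurableSpace F] [BorelSpace F] (μ : Measure F) [μ.IsAddHaarMeasure]

/-! ## §1  Outside the two localisation balls -/

omit [MeasurableSpace F] [BorelSpace F] in
/-- **Pointwise, outside the balls.**  Let `d = σ₁ − σ₂ ≠ 0`, `0 < ρ ≤ ‖d‖`, and suppose `‖σ − σ₁‖ > ρ`, `‖σ − σ₂‖ > ρ`.  Then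
`‖r₂(σ−σ₁)(σ−σ₂)‖⁻¹ ≤ 1[‖σ−σ₁‖ > ‖d‖]·‖r₂‖⁻¹‖σ−σ₁‖⁻² + 1[‖σ−σ₁‖ ≤ ‖d‖]·‖r₂‖⁻¹ρ⁻¹‖d‖⁻¹`. [cite: HarishChandra1999AdmissibleDistributions, §7] -/
theorem normAbs_inv_split_le_outside {r₂ σ₁ σ₂ : F} (hr₂ : r₂ ≠ 0) (hne : σ₁ ≠ σ₂) {ρ : ℝ≥0} (hρ : 0 < ρ)
    {σ : F} (h1 : ρ < normAbs F (σ - σ₁)) (h2 : ρ < normAbs F (σ - σ₂)) :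
    (((normAbs F (r₂ * (σ - σ₁) * (σ - σ₂)))⁻¹ : ℝ≥0) : ℝ≥0∞) ≤
      {σ : F | normAbs F (σ₁ - σ₂) < normAbs F (σ - σ₁)}.indicator (fun σ => ((((normAbs F r₂)⁻¹ * ((normAbs F (σ - σ₁))⁻¹) ^ 2 : ℝ≥0)) : ℝ≥0∞)) σ +
      {σ : F | normAbs F (σ - σ₁) ≤ normAbs F (σ₁ - σ₂)}.indicator
        (fun _ => ((((normAbs F r₂)⁻¹ * ρ⁻¹ * (normAbs F (σ₁ - σ₂))⁻¹ : ℝ≥0)) : ℝ≥0∞)) σ := by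
  have hd0 : 0 < normAbs F (σ₁ - σ₂) := pos_iff_ne_zero.2 ((map_ne_zero (normAbs F)).2 (sub_ne_zero.2 hne))
  have hr0 : 0 < normAbs F r₂ := pos_iff_ne_zero.2 ((map_ne_zero (normAbs F)).2 hr₂)
  have hkey : σ - σ₂ = (σ - σ₁) + (σ₁ - σ₂) := by ring
  by_cases hfar : normAbs F (σ₁ - σ₂) < normAbs F (σ - σ₁)
  · -- far region: `‖σ − σ₂‖ = ‖σ − σ₁‖`
    have heq : normAbs F (σ - σ₂) = normAbs F (σ - σ₁) := by rw [hkey]; exact normAbs_add_eq_of_lt hfar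
    rw [indicator_of_mem (show σ ∈ {σ : F | normAbs F (σ₁ - σ₂) < normAbs F (σ - σ₁)} from hfar),
      indicator_of_notMem (show σ ∉ {σ : F | normAbs F (σ - σ₁) ≤ normAbs F (σ₁ - σ₂)} from fun h => not_lt.2 h hfar), add_zero]
    refine ENNReal.coe_le_coe.2 (le_of_eq ?_)
    rw [map_mul, map_mul, heq, mul_inv, mul_inv, pow_two, mul_assoc]
  · -- middle region: product of distances `≥ ρ‖d‖`
    rw [not_lt] at hfar
    rw [indicator_of_notMem (show σ ∉ {σ : F | normAbs F (σ₁ - σ₂) < normAbs F (σ - σ₁)} from fun h => not_lt.2 hfar h),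
      indicator_of_mem (show σ ∈ {σ : F | normAbs F (σ - σ₁) ≤ normAbs F (σ₁ - σ₂)} from hfar), zero_add]
    refine ENNReal.coe_le_coe.2 ?_
    -- `‖d‖ ≤ max(‖σ−σ₁‖, ‖σ−σ₂‖)`, hence `ρ‖d‖ ≤ ‖σ−σ₁‖‖σ−σ₂‖`
    have hmax : normAbs F (σ₁ - σ₂) ≤ max (normAbs F (σ - σ₁)) (normAbs F (σ - σ₂)) := by
      have : σ₁ - σ₂ = (σ - σ₂) + (-(σ - σ₁)) := by ring
      rw [this, max_comm]
      refine (normAbs_add_le_max _ _).trans ?_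
      rw [normAbs_neg]
    have hprod : ρ * normAbs F (σ₁ - σ₂) ≤ normAbs F (σ - σ₁) * normAbs F (σ - σ₂) := by
      rcases le_max_iff.1 hmax with h | h
      · calc ρ * normAbs F (σ₁ - σ₂) ≤ normAbs F (σ - σ₂) * normAbs F (σ - σ₁) := mul_le_mul h2.le h bot_le bot_le
          _ = _ := mul_comm _ _
      · exact mul_le_mul h1.le h bot_le bot_le
    have hpos : 0 < ρ * normAbs F (σ₁ - σ₂) := mul_pos hρ hd0
    rw [map_mul, map_mul, mul_assoc, mul_inv, mul_assoc]
    refine mul_le_mul_of_nonneg_left ?_ bot_le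
    rw [← mul_inv]
    exact inv_anti₀ hpos hprod

/-- **Outside the balls, integrated**: with `O = {‖σ−σ₁‖ > ρ} ∩ {‖σ−σ₂‖ > ρ}`, `0 < ρ ≤ ‖d‖`:
`∫⁻ 1_O ‖R‖⁻¹ ≤ ‖r₂‖⁻¹‖d‖⁻¹ μ(𝒪) + ‖r₂‖⁻¹ρ⁻¹‖d‖⁻¹·(‖d‖ μ(𝒪))`. [cite: HarishChandra1999AdmissibleDistributions, §7] -/
theorem lintegral_indicator_outside_normAbs_inv_le {r₂ σ₁ σ₂ : F} (hr₂ : r₂ ≠ 0) (hne : σ₁ ≠ σ₂) {ρ : ℝ≥0} (hρ : 0 < ρ) :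
    ∫⁻ σ, ({σ : F | ρ < normAbs F (σ - σ₁)} ∩ {σ : F | ρ < normAbs F (σ - σ₂)}).indicator
        (fun σ => (((normAbs F (r₂ * (σ - σ₁) * (σ - σ₂)))⁻¹ : ℝ≥0) : ℝ≥0∞)) σ ∂μ ≤
      (((normAbs F r₂)⁻¹ * (normAbs F (σ₁ - σ₂))⁻¹ : ℝ≥0) : ℝ≥0∞) * μ (primePowBall F 0) +
      (((normAbs F r₂)⁻¹ * ρ⁻¹ * (normAbs F (σ₁ - σ₂))⁻¹ : ℝ≥0) : ℝ≥0∞) * ((normAbs F (σ₁ - σ₂) : ℝ≥0∞) * μ (primePowBall F 0)) := by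
  have hd0 : 0 < normAbs F (σ₁ - σ₂) := pos_iff_ne_zero.2 ((map_ne_zero (normAbs F)).2 (sub_ne_zero.2 hne))
  have hA : MeasurableSet {σ : F | normAbs F (σ₁ - σ₂) < normAbs F (σ - σ₁)} :=
    measurableSet_lt measurable_const (measurable_normAbs.comp (measurable_id.sub_const σ₁))
  have hB : MeasurableSet {σ : F | normAbs F (σ - σ₁) ≤ normAbs F (σ₁ - σ₂)} :=
    measurableSet_le (measurable_normAbs.comp (measurable_id.sub_const σ₁)) measurable_const
  -- pointwise bound
  have hpt : ∀ σ : F, ({σ : F | ρ < normAbs F (σ - σ₁)} ∩ {σ : F | ρ < normAbs F (σ - σ₂)}).indicator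
      (fun σ => (((normAbs F (r₂ * (σ - σ₁) * (σ - σ₂)))⁻¹ : ℝ≥0) : ℝ≥0∞)) σ ≤
      {σ : F | normAbs F (σ₁ - σ₂) < normAbs F (σ - σ₁)}.indicator (fun σ => ((((normAbs F r₂)⁻¹ * ((normAbs F (σ - σ₁))⁻¹) ^ 2 : ℝ≥0)) : ℝ≥0∞)) σ +
      {σ : F | normAbs F (σ - σ₁) ≤ normAbs F (σ₁ - σ₂)}.indicator
        (fun _ => ((((normAbs F r₂)⁻¹ * ρ⁻¹ * (normAbs F (σ₁ - σ₂))⁻¹ : ℝ≥0)) : ℝ≥0∞)) σ := by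
    intro σ
    by_cases hσ : σ ∈ {σ : F | ρ < normAbs F (σ - σ₁)} ∩ {σ : F | ρ < normAbs F (σ - σ₂)}
    · rw [indicator_of_mem hσ]; exact normAbs_inv_split_le_outside hr₂ hne hρ hσ.1 hσ.2
    · rw [indicator_of_notMem hσ]; exact bot_le
  refine (lintegral_mono hpt).trans ?_
  have hmeasA : Measurable fun σ : F => {σ : F | normAbs F (σ₁ - σ₂) < normAbs F (σ - σ₁)}.indicator
      (fun σ => ((((normAbs F r₂)⁻¹ * ((normAbs F (σ - σ₁))⁻¹) ^ 2 : ℝ≥0)) : ℝ≥0∞)) σ := by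
    refine Measurable.indicator (Measurable.coe_nnreal_ennreal ?_) hA
    exact measurable_const.mul (((measurable_normAbs.comp (measurable_id.sub_const σ₁)).inv).pow_const 2)
  rw [lintegral_add_left hmeasA]
  gcongr
  · -- the far region: the `‖v‖⁻²` tail, translated by `σ₁`
    have h1 : ∫⁻ σ, {σ : F | normAbs F (σ₁ - σ₂) < normAbs F (σ - σ₁)}.indicator
        (fun σ => ((((normAbs F r₂)⁻¹ * ((normAbs F (σ - σ₁))⁻¹) ^ 2 : ℝ≥0)) : ℝ≥0∞)) σ ∂μ =
        (((normAbs F r₂)⁻¹ : ℝ≥0) : ℝ≥0∞) * ∫⁻ v, {v : F | normAbs F (σ₁ - σ₂) < normAbs F v}.indicator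
          (fun v => ((((normAbs F v)⁻¹) ^ 2 : ℝ≥0) : ℝ≥0∞)) v ∂μ := by
      rw [← lintegral_const_mul' _ _ ENNReal.coe_ne_top,
        ← lintegral_sub_right_eq_self (μ := μ) (fun v => (((normAbs F r₂)⁻¹ : ℝ≥0) : ℝ≥0∞) *
          {v : F | normAbs F (σ₁ - σ₂) < normAbs F v}.indicator (fun v => ((((normAbs F v)⁻¹) ^ 2 : ℝ≥0) : ℝ≥0∞)) v) σ₁]
      refine lintegral_congr fun σ => ?_
      by_cases h : normAbs F (σ₁ - σ₂) < normAbs F (σ - σ₁)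
      · rw [indicator_of_mem (show σ ∈ {σ : F | normAbs F (σ₁ - σ₂) < normAbs F (σ - σ₁)} from h),
          indicator_of_mem (show σ - σ₁ ∈ {v : F | normAbs F (σ₁ - σ₂) < normAbs F v} from h), ENNReal.coe_mul]
      · rw [indicator_of_notMem (show σ ∉ {σ : F | normAbs F (σ₁ - σ₂) < normAbs F (σ - σ₁)} from h),
          indicator_of_notMem (show σ - σ₁ ∉ {v : F | normAbs F (σ₁ - σ₂) < normAbs F v} from h), mul_zero]
    rw [h1, ENNReal.coe_mul, mul_assoc]
    exact mul_le_mul_of_nonneg_left (lintegral_normAbs_inv_sq_indicator_lt_le μ hd0) bot_le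
  · -- the middle region: constant on a set of measure `≤ ‖d‖ μ(𝒪)`
    rw [lintegral_indicator_const hB]
    refine mul_le_mul_of_nonneg_left ?_ bot_le
    have h1 : μ {σ : F | normAbs F (σ - σ₁) ≤ normAbs F (σ₁ - σ₂)} = μ {v : F | normAbs F v ≤ normAbs F (σ₁ - σ₂)} := by
      have : {σ : F | normAbs F (σ - σ₁) ≤ normAbs F (σ₁ - σ₂)} = (fun σ => σ - σ₁) ⁻¹' {v : F | normAbs F v ≤ normAbs F (σ₁ - σ₂)} := rfl
      rw [this, show (fun σ : F => σ - σ₁) = fun σ => -σ₁ + σ from funext fun σ => by ring, measure_preimage_add]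
    rw [h1]
    exact measure_setOf_normAbs_le_le μ hd0

/-! ## §2  Translated balls -/

/-- **A translated ball carries at most `μ(𝒪)` of the truncated model weight**: `|∫_{v − c ∈ 𝔭^γ} 1[v ∉ 𝔭^b] ψ(v) dv| ≤ μ(𝒪)` — if `c ∈ 𝔭^γ` the
ball is `𝔭^γ` (★ model annulus); otherwise `‖v‖ = ‖c‖ > (q⁻¹)^γ` on it. [cite: Tate1950, §2.5] -/
theorem norm_setIntegral_translateBall_trunc_le (χ : QuasiChar F) (hχ2 : ∀ u, χ u * χ u = 1) (hχ1 : ∃ u, χ u ≠ 1) (c : F) (γ b : ℤ) :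
    ‖∫ v in {v : F | v - c ∈ primePowBall F γ}, (primePowBall F b)ᶜ.indicator
        (fun y => Function.extend ((↑) : Fˣ → F) (fun u => ((χ u : ℂˣ) : ℂ)) 0 y * ((((normAbs F y)⁻¹ : ℝ≥0) : ℝ) : ℂ)) v ∂μ‖ ≤ μ.real (primePowBall F 0) := by
  haveI : T2Space F := (isLocalField F).toT2Space
  by_cases hc : c ∈ primePowBall F γ
  · have hW : {v : F | v - c ∈ primePowBall F γ} = primePowBall F γ := by
      ext v
      refine ⟨fun (h : v - c ∈ primePowBall F γ) => ?_, fun h => ?_⟩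
      · have := add_mem_primePowBall h hc; rwa [sub_add_cancel] at this
      · show v - c ∈ primePowBall F γ
        rw [sub_eq_add_neg]; exact add_mem_primePowBall h (neg_mem_primePowBall hc)
    rw [hW]
    exact norm_setIntegral_ball_trunc_le μ χ hχ2 hχ1 γ b
  · have hcn : ((residueFieldCard F : ℝ≥0)⁻¹) ^ γ < normAbs F c := not_le.1 (fun h => hc (mem_primePowBall_iff.2 h))
    have hc0 : 0 < normAbs F c := lt_of_le_of_lt bot_le hcn
    have hWm : MeasurableSet {v : F | v - c ∈ primePowBall F γ} := (measurableSet_primePowBall γ).preimage (measurable_id.sub_const c)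
    have hWμ : μ {v : F | v - c ∈ primePowBall F γ} = μ (primePowBall F γ) := by
      rw [show {v : F | v - c ∈ primePowBall F γ} = (fun v => -c + v) ⁻¹' primePowBall F γ from by
        ext v; simp only [mem_setOf_eq, mem_preimage, neg_add_eq_sub], measure_preimage_add]
    have hnormv : ∀ v ∈ {v : F | v - c ∈ primePowBall F γ}, normAbs F v = normAbs F c := by
      intro v (hv : v - c ∈ primePowBall F γ)
      have h1 : normAbs F (v - c) < normAbs F c := (mem_primePowBall_iff.1 hv).trans_lt hcn
      rw [show v = c + (v - c) by ring]; exact normAbs_add_eq_of_lt h1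
    have hbd : ∀ v ∈ {v : F | v - c ∈ primePowBall F γ}, ‖(primePowBall F b)ᶜ.indicator
        (fun y => Function.extend ((↑) : Fˣ → F) (fun u => ((χ u : ℂˣ) : ℂ)) 0 y * ((((normAbs F y)⁻¹ : ℝ≥0) : ℝ) : ℂ)) v‖ ≤ ((normAbs F c)⁻¹ : ℝ) := by
      intro v hv
      refine (norm_indicator_le_norm_self _ _).trans ?_
      rw [norm_mul, Complex.norm_real, Real.norm_eq_abs, abs_of_nonneg (NNReal.coe_nonneg _), NNReal.coe_inv, hnormv v hv]
      calc _ ≤ 1 * ((normAbs F c : ℝ))⁻¹ := by gcongr; exact norm_extend_le_one χ hχ2 _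
        _ = _ := one_mul _
    have hfin : μ {v : F | v - c ∈ primePowBall F γ} < ⊤ := by rw [hWμ]; exact (isCompact_primePowBall γ).measure_lt_top
    refine (norm_setIntegral_le_of_norm_le_const hfin hbd).trans ?_
    rw [measureReal_def, hWμ, ← measureReal_def, measureReal_primePowBall]
    have hle : ((residueFieldCard F : ℝ)⁻¹) ^ γ ≤ (normAbs F c : ℝ) := by
      have := hcn.le
      rw [← NNReal.coe_le_coe, NNReal.coe_zpow, NNReal.coe_inv, NNReal.coe_natCast] at this
      exact this
    have hcpos : (0 : ℝ) < normAbs F c := by exact_mod_cast hc0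
    calc ((normAbs F c : ℝ))⁻¹ * (((residueFieldCard F : ℝ)⁻¹) ^ γ * μ.real (primePowBall F 0))
        = (((normAbs F c : ℝ))⁻¹ * ((residueFieldCard F : ℝ)⁻¹) ^ γ) * μ.real (primePowBall F 0) := by ring
      _ ≤ 1 * μ.real (primePowBall F 0) := by
          refine mul_le_mul_of_nonneg_right ?_ measureReal_nonneg
          rw [inv_mul_le_iff₀ hcpos, mul_one]
          exact hle
      _ = μ.real (primePowBall F 0) := one_mul _

omit [BorelSpace F] [μ.IsAddHaarMeasure] in
/-- **Localisation on a sub-ball** of the localisation ball: if every `v ∈ V` has `‖v‖ ≤ ‖d‖(q⁻¹)^e`, then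
`∫_V 1[a v(d+v) ∉ 𝔭^b] ψ(a v(d+v)) dv = χ̃(ad)‖ad‖⁻¹ · ∫_V 1[v ∉ 𝔭^{b−w}] ψ(v) dv`. [cite: HarishChandra1999AdmissibleDistributions, §7] -/
theorem setIntegral_rootFactor_trunc_eq_of_subset (χ : QuasiChar F) {e : ℕ} (he : 1 ≤ e)
    (hce : ∀ t ∈ primePowBall F (e : ℤ), Function.extend ((↑) : Fˣ → F) (fun u => ((χ u : ℂˣ) : ℂ)) 0 (1 + t) = 1)
    {a d : F} (hd : d ≠ 0) {w : ℤ} (hw : normAbs F (a * d) = ((residueFieldCard F : ℝ≥0)⁻¹) ^ w)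
    {V : Set F} (hV : MeasurableSet V) (hVd : ∀ v ∈ V, normAbs F v ≤ normAbs F d * ((residueFieldCard F : ℝ≥0)⁻¹) ^ (e : ℤ)) (b : ℤ) :
    ∫ v in V, (primePowBall F b)ᶜ.indicator
        (fun y => Function.extend ((↑) : Fˣ → F) (fun u => ((χ u : ℂˣ) : ℂ)) 0 y * ((((normAbs F y)⁻¹ : ℝ≥0) : ℝ) : ℂ)) (a * v * (d + v)) ∂μ =
      (Function.extend ((↑) : Fˣ → F) (fun u => ((χ u : ℂˣ) : ℂ)) 0 (a * d) * ((((normAbs F (a * d))⁻¹ : ℝ≥0) : ℝ) : ℂ)) *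
        ∫ v in V, (primePowBall F (b - w))ᶜ.indicator
          (fun v => Function.extend ((↑) : Fˣ → F) (fun u => ((χ u : ℂˣ) : ℂ)) 0 v * ((((normAbs F v)⁻¹ : ℝ≥0) : ℝ) : ℂ)) v ∂μ := by
  rw [← integral_const_mul]
  refine setIntegral_congr_fun hV fun v hv => ?_
  have hv' := hVd v hv
  have hmem : a * v * (d + v) ∈ (primePowBall F b)ᶜ ↔ v ∈ (primePowBall F (b - w))ᶜ := by
    rw [Set.mem_compl_iff, Set.mem_compl_iff, rootFactor_mem_primePowBall_iff he hd hw hv']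
  by_cases h : v ∈ (primePowBall F (b - w))ᶜ
  · rw [indicator_of_mem (hmem.2 h), indicator_of_mem h, extend_rootFactor_eq χ hce a hd hv', normAbs_rootFactor_eq he a hd hv',
      mul_inv, NNReal.coe_mul, Complex.ofReal_mul]
    ring
  · rw [indicator_of_notMem (fun h' => h (hmem.1 h')), indicator_of_notMem h, mul_zero]

/-! ## §3  The split cell quadratic -/

/-- **SPLIT CASE, UNIFORM BOUND.**  For a quadratic `χ ≠ 1` with conductor ball `𝔭^e` (`χ̃(1+t) = 1` on `𝔭^e`, `e ≥ 1`), `r₂ ≠ 0`, `σ₁ ≠ σ₂`, every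
truncation `b` and every ball `𝔭^β`:
`|∫_{𝔭^β} 1[R σ ∉ 𝔭^b] χ̃(R σ)‖R σ‖⁻¹ dσ| ≤ (3 + q^e)·‖r₂(σ₁ − σ₂)‖⁻¹·μ(𝒪)`, `R(σ) = r₂(σ−σ₁)(σ−σ₂)` (`‖r₂(σ₁−σ₂)‖ = |disc R|^{1∕2}`).
[cite: HarishChandra1999AdmissibleDistributions, §7] [cite: LabesseLanglands1979, §2] -/
theorem norm_setIntegral_trunc_split_le (χ : QuasiChar F) (hχ2 : ∀ u, χ u * χ u = 1) (hχ1 : ∃ u, χ u ≠ 1) {e : ℕ} (he : 1 ≤ e)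
    (hce : ∀ t ∈ primePowBall F (e : ℤ), Function.extend ((↑) : Fˣ → F) (fun u => ((χ u : ℂˣ) : ℂ)) 0 (1 + t) = 1)
    {r₂ σ₁ σ₂ : F} (hr₂ : r₂ ≠ 0) (hne : σ₁ ≠ σ₂) (b β : ℤ) :
    ‖∫ σ in primePowBall F β, (primePowBall F b)ᶜ.indicator
        (fun y => Function.extend ((↑) : Fˣ → F) (fun u => ((χ u : ℂˣ) : ℂ)) 0 y * ((((normAbs F y)⁻¹ : ℝ≥0) : ℝ) : ℂ)) (r₂ * (σ - σ₁) * (σ - σ₂)) ∂μ‖ ≤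
      (3 + (residueFieldCard F : ℝ) ^ e) * ((normAbs F (r₂ * (σ₁ - σ₂)))⁻¹ : ℝ) * μ.real (primePowBall F 0) := by
  haveI : T2Space F := (isLocalField F).toT2Space
  have hq0 : (0 : ℝ≥0) < (residueFieldCard F : ℝ≥0)⁻¹ := inv_residueFieldCard_pos
  set d : F := σ₁ - σ₂ with hd
  have hd0 : d ≠ 0 := sub_ne_zero.2 hne
  have hdpos : 0 < normAbs F d := pos_iff_ne_zero.2 ((map_ne_zero (normAbs F)).2 hd0)
  have hr0 : 0 < normAbs F r₂ := pos_iff_ne_zero.2 ((map_ne_zero (normAbs F)).2 hr₂)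
  obtain ⟨k, hk⟩ := exists_normAbs_eq_inv_zpow hd0
  obtain ⟨w, hw⟩ := exists_normAbs_eq_inv_zpow (mul_ne_zero hr₂ hd0)
  have hw' : normAbs F (r₂ * -d) = ((residueFieldCard F : ℝ≥0)⁻¹) ^ w := by rw [mul_neg, normAbs_neg, hw]
  set α : ℤ := k + e with hαdef
  set ρ : ℝ≥0 := ((residueFieldCard F : ℝ≥0)⁻¹) ^ α with hρdef
  have hρ : 0 < ρ := zpow_pos hq0 α
  have hρeq : ρ = normAbs F d * ((residueFieldCard F : ℝ≥0)⁻¹) ^ (e : ℤ) := by rw [hρdef, hαdef, hk, ← zpow_add₀ hq0.ne']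
  have hρlt : ρ < normAbs F d := by
    rw [hρeq]; conv_rhs => rw [← mul_one (normAbs F d)]
    exact mul_lt_mul_of_pos_left (by rw [zpow_natCast]; exact pow_lt_one₀ bot_le inv_residueFieldCard_lt_one (by omega)) hdpos
  set g : F → ℂ := fun σ => (primePowBall F b)ᶜ.indicator
    (fun y => Function.extend ((↑) : Fˣ → F) (fun u => ((χ u : ℂˣ) : ℂ)) 0 y * ((((normAbs F y)⁻¹ : ℝ≥0) : ℝ) : ℂ)) (r₂ * (σ - σ₁) * (σ - σ₂)) with hgdef
  set B₁ : Set F := {σ : F | σ - σ₁ ∈ primePowBall F α} with hB₁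
  set B₂ : Set F := {σ : F | σ - σ₂ ∈ primePowBall F α} with hB₂
  set O : Set F := {σ : F | ρ < normAbs F (σ - σ₁)} ∩ {σ : F | ρ < normAbs F (σ - σ₂)} with hO
  have hB₁m : MeasurableSet B₁ := (measurableSet_primePowBall α).preimage (measurable_id.sub_const σ₁)
  have hB₂m : MeasurableSet B₂ := (measurableSet_primePowBall α).preimage (measurable_id.sub_const σ₂)
  have hOm : MeasurableSet O := (measurableSet_lt measurable_const (measurable_normAbs.comp (measurable_id.sub_const σ₁))).inter
    (measurableSet_lt measurable_const (measurable_normAbs.comp (measurable_id.sub_const σ₂)))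
  have hmemB : ∀ (c σ : F), σ ∈ {σ : F | σ - c ∈ primePowBall F α} ↔ normAbs F (σ - c) ≤ ρ := fun c σ => by rw [mem_setOf_eq, mem_primePowBall_iff]
  have hdisj : ∀ σ : F, σ ∈ B₁ → σ ∉ B₂ := by
    intro σ h1 h2
    have : d ∈ primePowBall F α := by
      have := add_mem_primePowBall (neg_mem_primePowBall h1) h2
      rwa [show -(σ - σ₁) + (σ - σ₂) = d by rw [hd]; ring] at this
    exact not_le.2 hρlt (mem_primePowBall_iff.1 this)
  have hpt : ∀ σ : F, g σ = B₁.indicator g σ + B₂.indicator g σ + O.indicator g σ := by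
    intro σ
    by_cases h1 : σ ∈ B₁
    · have hO' : σ ∉ O := fun h => not_le.2 h.1 ((hmemB σ₁ σ).1 h1)
      rw [indicator_of_mem h1, indicator_of_notMem (hdisj σ h1), indicator_of_notMem hO', add_zero, add_zero]
    · by_cases h2 : σ ∈ B₂
      · have hO' : σ ∉ O := fun h => not_le.2 h.2 ((hmemB σ₂ σ).1 h2)
        rw [indicator_of_notMem h1, indicator_of_mem h2, indicator_of_notMem hO', zero_add, add_zero]
      · have hO' : σ ∈ O := ⟨not_le.1 (fun h => h1 ((hmemB σ₁ σ).2 h)), not_le.1 (fun h => h2 ((hmemB σ₂ σ).2 h))⟩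
        rw [indicator_of_notMem h1, indicator_of_notMem h2, indicator_of_mem hO', zero_add, zero_add]
  have hfin : μ (primePowBall F β) ≠ ⊤ := (isCompact_primePowBall β).measure_lt_top.ne
  have hgm : Measurable g := by
    refine (((measurable_extend χ).mul measurable_normInv).indicator (measurableSet_primePowBall b).compl).comp ?_
    exact ((continuous_const.mul (continuous_id.sub continuous_const)).mul (continuous_id.sub continuous_const)).measurable
  have hgb : ∀ σ, ‖g σ‖ ≤ (residueFieldCard F : ℝ) ^ b := fun σ => norm_truncWeight_le χ hχ2 b _
  have hint : ∀ {A : Set F}, MeasurableSet A → IntegrableOn (A.indicator g) (primePowBall F β) μ := fun hA =>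
    Measure.integrableOn_of_bounded (M := (residueFieldCard F : ℝ) ^ b) hfin (hgm.indicator hA).aestronglyMeasurable
      (Eventually.of_forall fun σ => (norm_indicator_le_norm_self _ _).trans (hgb σ))
  have hsplit : ∫ σ in primePowBall F β, g σ ∂μ =
      ∫ σ in primePowBall F β, B₁.indicator g σ ∂μ + ∫ σ in primePowBall F β, B₂.indicator g σ ∂μ + ∫ σ in primePowBall F β, O.indicator g σ ∂μ := by
    have h12 : ∫ σ in primePowBall F β, (B₁.indicator g σ + B₂.indicator g σ) ∂μ =
        ∫ σ in primePowBall F β, B₁.indicator g σ ∂μ + ∫ σ in primePowBall F β, B₂.indicator g σ ∂μ := integral_add (hint hB₁m) (hint hB₂m)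
    have h123 : ∫ σ in primePowBall F β, (B₁.indicator g σ + B₂.indicator g σ + O.indicator g σ) ∂μ =
        ∫ σ in primePowBall F β, (B₁.indicator g σ + B₂.indicator g σ) ∂μ + ∫ σ in primePowBall F β, O.indicator g σ ∂μ :=
      integral_add ((hint hB₁m).add (hint hB₂m)) (hint hOm)
    rw [setIntegral_congr_fun (measurableSet_primePowBall β) (fun σ _ => hpt σ), h123, h12]
  have hball : ∀ (c d' : F), d' ≠ 0 → normAbs F d' = normAbs F d → normAbs F (r₂ * d') = ((residueFieldCard F : ℝ≥0)⁻¹) ^ w →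
      (∀ v : F, r₂ * (c + v - σ₁) * (c + v - σ₂) = r₂ * v * (d' + v)) →
      ‖∫ σ in primePowBall F β, {σ : F | σ - c ∈ primePowBall F α}.indicator g σ ∂μ‖ ≤ ((normAbs F (r₂ * d))⁻¹ : ℝ) * μ.real (primePowBall F 0) := by
    intro c d' hd' hdd hwd hRc
    by_cases hex : ∃ σ₀ ∈ primePowBall F β, σ₀ ∈ {σ : F | σ - c ∈ primePowBall F α}
    · obtain ⟨σ₀, hσ₀β, hσ₀c⟩ := hex
      set γ : ℤ := max α β with hγ
      have hcap : ∀ σ : F, σ ∈ primePowBall F β → ({σ : F | σ - c ∈ primePowBall F α}.indicator g σ =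
          {σ : F | σ - σ₀ ∈ primePowBall F γ}.indicator g σ) := by
        intro σ hσβ
        have hσ0β : σ - σ₀ ∈ primePowBall F β := by
          have := add_mem_primePowBall hσβ (neg_mem_primePowBall hσ₀β); rwa [← sub_eq_add_neg] at this
        by_cases hσc : σ ∈ {σ : F | σ - c ∈ primePowBall F α}
        · have hσ0α : σ - σ₀ ∈ primePowBall F α := by
            have := add_mem_primePowBall (show σ - c ∈ primePowBall F α from hσc) (neg_mem_primePowBall (show σ₀ - c ∈ primePowBall F α from hσ₀c))
            rwa [show σ - c + -(σ₀ - c) = σ - σ₀ by ring] at this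
          have hσγ : σ - σ₀ ∈ primePowBall F γ := by
            rcases le_total α β with h | h
            · rw [hγ, max_eq_right h]; exact hσ0β
            · rw [hγ, max_eq_left h]; exact hσ0α
          rw [indicator_of_mem hσc, indicator_of_mem (show σ ∈ {σ : F | σ - σ₀ ∈ primePowBall F γ} from hσγ)]
        · have hσγ : σ ∉ {σ : F | σ - σ₀ ∈ primePowBall F γ} := by
            intro (h : σ - σ₀ ∈ primePowBall F γ)
            refine hσc ?_
            show σ - c ∈ primePowBall F α
            have h' : σ - σ₀ ∈ primePowBall F α := primePowBall_antitone (le_max_left _ _) h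
            have := add_mem_primePowBall h' (show σ₀ - c ∈ primePowBall F α from hσ₀c)
            rwa [show σ - σ₀ + (σ₀ - c) = σ - c by ring] at this
          rw [indicator_of_notMem hσc, indicator_of_notMem hσγ]
      rw [setIntegral_congr_fun (measurableSet_primePowBall β) hcap, setIntegral_indicator_subBall_eq μ (le_max_right α β) σ₀ g,
        indicator_of_mem hσ₀β, one_mul]
      have hVm : MeasurableSet {u : F | u - (σ₀ - c) ∈ primePowBall F γ} := (measurableSet_primePowBall γ).preimage (measurable_id.sub_const (σ₀ - c))
      have htr : ∫ v in primePowBall F γ, g (σ₀ + v) ∂μ = ∫ u in {u : F | u - (σ₀ - c) ∈ primePowBall F γ}, g (c + u) ∂μ := by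
        rw [← integral_indicator (measurableSet_primePowBall γ), ← integral_indicator hVm,
          ← integral_add_left_eq_self (μ := μ) ({u : F | u - (σ₀ - c) ∈ primePowBall F γ}.indicator fun u => g (c + u)) (σ₀ - c)]
        refine integral_congr_ae (Eventually.of_forall fun v => ?_)
        simp only
        by_cases hv : v ∈ primePowBall F γ
        · rw [indicator_of_mem hv, indicator_of_mem (show σ₀ - c + v ∈ {u : F | u - (σ₀ - c) ∈ primePowBall F γ} by simpa using hv),
            show c + (σ₀ - c + v) = σ₀ + v by ring]
        · rw [indicator_of_notMem hv, indicator_of_notMem (show σ₀ - c + v ∉ {u : F | u - (σ₀ - c) ∈ primePowBall F γ} by simpa using hv)]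
      rw [htr]
      have hVd : ∀ u ∈ {u : F | u - (σ₀ - c) ∈ primePowBall F γ}, normAbs F u ≤ normAbs F d' * ((residueFieldCard F : ℝ≥0)⁻¹) ^ (e : ℤ) := by
        intro u (hu : u - (σ₀ - c) ∈ primePowBall F γ)
        have h1 : u ∈ primePowBall F α := by
          have := add_mem_primePowBall (primePowBall_antitone (le_max_left α β) hu) (show σ₀ - c ∈ primePowBall F α from hσ₀c)
          rwa [sub_add_cancel] at this
        rw [hdd, ← hρeq]
        exact mem_primePowBall_iff.1 h1
      simp only [hgdef, hRc]
      rw [setIntegral_rootFactor_trunc_eq_of_subset μ χ he hce hd' hwd hVm hVd b, norm_mul, norm_mul, Complex.norm_real,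
        Real.norm_eq_abs, abs_of_nonneg (NNReal.coe_nonneg _), NNReal.coe_inv, hwd, ← hw]
      calc _ ≤ 1 * ((normAbs F (r₂ * d) : ℝ))⁻¹ * μ.real (primePowBall F 0) := by
            gcongr
            · exact norm_extend_le_one χ hχ2 _
            · exact norm_setIntegral_translateBall_trunc_le μ χ hχ2 hχ1 _ γ _
        _ = _ := by ring
    · have h0 : ∀ σ ∈ primePowBall F β, {σ : F | σ - c ∈ primePowBall F α}.indicator g σ = 0 :=
        fun σ hσ => indicator_of_notMem (fun h => hex ⟨σ, hσ, h⟩) _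
      rw [setIntegral_congr_fun (measurableSet_primePowBall β) h0, integral_zero, norm_zero]
      positivity
  have hb1 := hball σ₁ d hd0 rfl hw (fun v => by rw [hd]; ring)
  have hb2 := hball σ₂ (-d) (neg_ne_zero.2 hd0) (normAbs_neg d) hw' (fun v => by rw [hd]; ring)
  have hout : ‖∫ σ in primePowBall F β, O.indicator g σ ∂μ‖ ≤
      (1 + (residueFieldCard F : ℝ) ^ e) * ((normAbs F (r₂ * d))⁻¹ : ℝ) * μ.real (primePowBall F 0) := by
    have hfinO : μ (primePowBall F 0) ≠ ⊤ := (isCompact_primePowBall 0).measure_lt_top.ne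
    have hptO : ∀ σ : F, ENNReal.ofReal ‖O.indicator g σ‖ ≤
        O.indicator (fun σ => (((normAbs F (r₂ * (σ - σ₁) * (σ - σ₂)))⁻¹ : ℝ≥0) : ℝ≥0∞)) σ := by
      intro σ
      by_cases hσ : σ ∈ O
      · rw [indicator_of_mem hσ, indicator_of_mem hσ, ← ENNReal.ofReal_coe_nnreal]
        refine ENNReal.ofReal_le_ofReal ((norm_indicator_le_norm_self _ _).trans ?_)
        rw [norm_mul, Complex.norm_real, Real.norm_eq_abs, abs_of_nonneg (NNReal.coe_nonneg _), NNReal.coe_inv]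
        calc _ ≤ 1 * ((normAbs F (r₂ * (σ - σ₁) * (σ - σ₂)) : ℝ))⁻¹ := by gcongr; exact norm_extend_le_one χ hχ2 _
          _ = _ := one_mul _
      · rw [indicator_of_notMem hσ, indicator_of_notMem hσ, norm_zero, ENNReal.ofReal_zero]
    have hlin := lintegral_indicator_outside_normAbs_inv_le μ hr₂ hne hρ
    have hne' : (((normAbs F r₂)⁻¹ * (normAbs F (σ₁ - σ₂))⁻¹ : ℝ≥0) : ℝ≥0∞) * μ (primePowBall F 0) +
        (((normAbs F r₂)⁻¹ * ρ⁻¹ * (normAbs F (σ₁ - σ₂))⁻¹ : ℝ≥0) : ℝ≥0∞) * ((normAbs F (σ₁ - σ₂) : ℝ≥0∞) * μ (primePowBall F 0)) ≠ ⊤ :=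
      ENNReal.add_ne_top.2 ⟨ENNReal.mul_ne_top ENNReal.coe_ne_top hfinO,
        ENNReal.mul_ne_top ENNReal.coe_ne_top (ENNReal.mul_ne_top ENNReal.coe_ne_top hfinO)⟩
    refine (norm_integral_le_lintegral_norm _).trans ?_
    refine (ENNReal.toReal_mono hne' (((lintegral_mono fun σ => hptO σ).trans (lintegral_mono' Measure.restrict_le_self le_rfl)).trans hlin)).trans ?_
    rw [ENNReal.toReal_add (ENNReal.mul_ne_top ENNReal.coe_ne_top hfinO) (ENNReal.mul_ne_top ENNReal.coe_ne_top (ENNReal.mul_ne_top ENNReal.coe_ne_top hfinO)),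
      ENNReal.toReal_mul, ENNReal.toReal_mul, ENNReal.toReal_mul, ← measureReal_def, ENNReal.coe_toReal, ENNReal.coe_toReal, ENNReal.coe_toReal]
    have hdne : (normAbs F d : ℝ) ≠ 0 := by exact_mod_cast hdpos.ne'
    have hrne : (normAbs F r₂ : ℝ) ≠ 0 := by exact_mod_cast hr0.ne'
    have hqne : (residueFieldCard F : ℝ) ≠ 0 := Nat.cast_ne_zero.2 (residueFieldCard_ne_zero F)
    have hρinv : ((ρ : ℝ≥0) : ℝ)⁻¹ = (residueFieldCard F : ℝ) ^ e * ((normAbs F d : ℝ))⁻¹ := by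
      rw [hρeq, NNReal.coe_mul, NNReal.coe_zpow, NNReal.coe_inv, NNReal.coe_natCast, zpow_natCast, inv_pow]
      field_simp
    have hdR : (normAbs F (r₂ * d) : ℝ) = normAbs F r₂ * normAbs F d := by rw [map_mul, NNReal.coe_mul]
    rw [hdR]
    push_cast
    rw [← hd, hρinv]
    refine le_of_eq ?_
    field_simp
  rw [hsplit]
  calc _ ≤ ‖∫ σ in primePowBall F β, B₁.indicator g σ ∂μ‖ + ‖∫ σ in primePowBall F β, B₂.indicator g σ ∂μ‖ + ‖∫ σ in primePowBall F β, O.indicator g σ ∂μ‖ :=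
        (norm_add_le _ _).trans (add_le_add (norm_add_le _ _) le_rfl)
    _ ≤ ((normAbs F (r₂ * d))⁻¹ : ℝ) * μ.real (primePowBall F 0) + ((normAbs F (r₂ * d))⁻¹ : ℝ) * μ.real (primePowBall F 0) +
          (1 + (residueFieldCard F : ℝ) ^ e) * ((normAbs F (r₂ * d))⁻¹ : ℝ) * μ.real (primePowBall F 0) := add_le_add (add_le_add hb1 hb2) hout
    _ = (3 + (residueFieldCard F : ℝ) ^ e) * ((normAbs F (r₂ * (σ₁ - σ₂)))⁻¹ : ℝ) * μ.real (primePowBall F 0) := by rw [← hd]; ring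

end Summit.HodgeConjecture.HodgeConjecture.Cruxes.H413.K2E3LocalFieldQuadraticWeightBoundSplit

end
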